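import Summits.CriticalPhenomena.PercolationContinuityZ3.Theorems.PercNearOneGluingNoHeavyLowerTailKnQuestion8CoefficientwiseGrandOneSided
import Summits.CriticalPhenomena.PercolationContinuityZ3.Theorems.PercNearOneGluingNoHeavyLowerTailKnQuestion8CoefficientwiseMirrorWeighted
import HarnessLib

/-!
# Conjecture GRAND for a pendant conditioning vertex

Support file (`--supports stmt-CriticalPhenomena-4575`, closed), prover `prim-cplus-coupling` (gen 28).  No definitions, no notations, no named
facts, no sorries; standard axioms.  Memo `prim-cplus-coupling/A5-COUPLING-gen28.md` §1 (GRAND), §2.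

GRAND (see …CoefficientwiseGrandOneSided for the statement and the dictionary with vdBHK 1.3/1.5): on `S = {z ∉ C_x s} ∩ {z ∉ C_x sᶜ}`, for `F, G` monotone
in the grand order (`K ↑, L ↓, C_z(red) ↓, C_z(blue) ↑`), `0 ≤ Σ_S (F(Q s) − F(Q sᶜ))(G(Q s) − G(Q sᶜ))`, `Q s = (C_x s, C_x sᶜ, C_z s, C_z sᶜ)`.
* `Coefficientwise.grand_offCluster_nonneg_sub` — the one-sided theorem on the colourings of an edge subset `E'` (transport along `{i // i ∈ E'}`);
* `Coefficientwise.grand_pendant` — **GRAND for a leaf `z`** (edge `e₀ = {z,v}`): resolving the colour of `e₀` (`C_z = {z} ∪ C_v` resp. `{z}`, constraint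
  `v ∉ C_x`) and reindexing the blue half by the swap gives `Σ_{t ⊆ E∖e₀ : v ∉ C_x t} (F(Q₁) − F(Q₁^sw))(G(Q₁) − G(Q₁^sw))`,
  `Q₁ = (C_x t, C_x(E∖e₀∖t), {z} ∪ C_v t, {z})`, which is `grand_offCluster_nonneg_sub` with `A = {v}` and `F(·,·,{z} ∪ R,{z}) ≤ F(·,·,{z},{z} ∪ R)`.
  Corollaries: SUPER (`super_pendant`), CROSS (`cross_pendant`) and CW-PA (`cwpa_pendant`) for pendant `z` are all faces of this statement.
[cite: KozmaNitzan2024, Questions 8–9 (§5.5 p. 36) (context: the Question-8 pocket covariance programme)]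
-/

namespace Summit.CriticalPhenomena.PercolationContinuityZ3.Theorems

open Finset Literature.Probability.Percolation

namespace Coefficientwise

variable {ι V : Type*}

section pendant
variable [DecidableEq ι]

open Classical in
/-- `grand_offCluster_nonneg` on the colourings of an edge subset `E'` (transport along `{i // i ∈ E'}`). [this work] -/
theorem grand_offCluster_nonneg_sub (ends : ι → Sym2 V) (E' : Finset ι) (x : V) (A : Set V) (F₁ F₁' F₂ F₂' : Set V → Set V → Set V → ℝ)
    (m₁ : ∀ a a' b S, a ⊆ a' → F₁ a b S ≤ F₁ a' b S) (n₁ : ∀ a b b' S, b ⊆ b' → F₁ a b' S ≤ F₁ a b S)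
    (m₁' : ∀ a a' b S, a ⊆ a' → F₁' a b S ≤ F₁' a' b S) (n₁' : ∀ a b b' S, b ⊆ b' → F₁' a b' S ≤ F₁' a b S) (le₁ : ∀ a b S, F₁ a b S ≤ F₁' a b S)
    (m₂ : ∀ a a' b S, a ⊆ a' → F₂ a b S ≤ F₂ a' b S) (n₂ : ∀ a b b' S, b ⊆ b' → F₂ a b' S ≤ F₂ a b S)
    (m₂' : ∀ a a' b S, a ⊆ a' → F₂' a b S ≤ F₂' a' b S) (n₂' : ∀ a b b' S, b ⊆ b' → F₂' a b' S ≤ F₂' a b S) (le₂ : ∀ a b S, F₂ a b S ≤ F₂' a b S) :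
    0 ≤ ∑ t ∈ E'.powerset.filter (fun t : Finset ι => ∀ a ∈ A, a ∉ openCluster (ends '' (↑t : Set ι)) x),
      (F₁ (openCluster (ends '' (↑t : Set ι)) x) (openCluster (ends '' (↑(E' \ t) : Set ι)) x) {y | ∃ a ∈ A, y ∈ openCluster (ends '' (↑t : Set ι)) a}
        - F₁' (openCluster (ends '' (↑(E' \ t) : Set ι)) x) (openCluster (ends '' (↑t : Set ι)) x) {y | ∃ a ∈ A, y ∈ openCluster (ends '' (↑t : Set ι)) a}) *
      (F₂ (openCluster (ends '' (↑t : Set ι)) x) (openCluster (ends '' (↑(E' \ t) : Set ι)) x) {y | ∃ a ∈ A, y ∈ openCluster (ends '' (↑t : Set ι)) a}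
        - F₂' (openCluster (ends '' (↑(E' \ t) : Set ι)) x) (openCluster (ends '' (↑t : Set ι)) x) {y | ∃ a ∈ A, y ∈ openCluster (ends '' (↑t : Set ι)) a}) := by
  set emb : {i // i ∈ E'} ↪ ι := Function.Embedding.subtype _ with hemb
  have key := grand_offCluster_nonneg (ends ∘ Subtype.val : {i // i ∈ E'} → Sym2 V) x A F₁ F₁' F₂ F₂' m₁ n₁ m₁' n₁' le₁ m₂ n₂ m₂' n₂' le₂
  have map_compl : ∀ t : Finset {i // i ∈ E'}, (tᶜ).map emb = E' \ t.map emb := by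
    intro t
    ext i
    simp only [Finset.mem_map, Finset.mem_compl, Finset.mem_sdiff, hemb, Function.Embedding.coe_subtype]
    constructor
    · rintro ⟨⟨j, hj⟩, hjt, rfl⟩
      exact ⟨hj, fun ⟨⟨k, hk⟩, hkt, hkj⟩ => hjt (by cases hkj; exact hkt)⟩
    · rintro ⟨hiE, hnot⟩
      exact ⟨⟨i, hiE⟩, fun hit => hnot ⟨⟨i, hiE⟩, hit, rfl⟩, rfl⟩
  have map_sub : ∀ t : Finset {i // i ∈ E'}, t.map emb ⊆ E' := by
    intro t i hi
    obtain ⟨⟨j, hj⟩, _, rfl⟩ := Finset.mem_map.mp hi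
    exact hj
  refine key.trans_eq ?_
  refine Finset.sum_bij' (fun t _ => t.map emb) (fun t _ => t.subtype (· ∈ E')) ?_ ?_ ?_ ?_ ?_
  · intro t ht
    rw [Finset.mem_filter] at ht ⊢
    refine ⟨Finset.mem_powerset.mpr (map_sub t), ?_⟩
    rw [← image_map_subtype]; exact ht.2
  · intro t ht
    rw [Finset.mem_filter] at ht ⊢
    refine ⟨Finset.mem_univ _, ?_⟩
    have hsub : t ⊆ E' := Finset.mem_powerset.mp ht.1
    rw [image_map_subtype, Finset.subtype_map_of_mem (fun i hi => hsub hi)]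
    exact ht.2
  · intro t _
    ext ⟨i, hi⟩
    rw [Finset.mem_subtype, Finset.mem_map]
    constructor
    · rintro ⟨⟨j, hj⟩, hjt, hji⟩
      have hji' : j = i := by simpa [hemb] using hji
      subst hji'
      exact hjt
    · intro h
      exact ⟨⟨i, hi⟩, h, by simp [hemb]⟩
  · intro t ht
    have hsub : t ⊆ E' := Finset.mem_powerset.mp (Finset.mem_filter.mp ht).1
    exact Finset.subtype_map_of_mem (fun i hi => hsub hi)
  · intro t _
    rw [image_map_subtype, image_map_subtype ends E' (tᶜ), map_compl]

variable [Fintype ι]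

open Classical in
/-- **GRAND for a pendant conditioning vertex.**  If `z ≠ x` is a leaf (`e₀ = {z,v}` its only edge, `z ≠ v`) and `F, G : Set V → Set V → Set V → Set V → ℝ`
are monotone in the grand order (increasing in the 1st and 4th, decreasing in the 2nd and 3rd argument), then with `Q s = (C_x s, C_x sᶜ, C_z s, C_z sᶜ)`
  `0 ≤ Σ_{s : z ∉ C_x s, z ∉ C_x sᶜ} (F(Q s) − F(Q sᶜ))·(G(Q s) − G(Q sᶜ))`.
Proof: resolve the colour of `e₀` (`C_z = {z} ∪ C_v` resp. `{z}`, constraint `v ∉ C_x`), reindex the blue half by the swap, and apply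
`grand_offCluster_nonneg_sub` with `A = {v}`, `F₁(a,b,S) = F(a,b,{z} ∪ S,{z}) ≤ F₁♯(a,b,S) = F(a,b,{z},{z} ∪ S)`. [this work] -/
theorem grand_pendant (ends : ι → Sym2 V) {z v x : V} {e₀ : ι} (he₀ : ends e₀ = s(z, v))
    (hpend : ∀ i, z ∈ ends i → i = e₀) (hzx : z ≠ x) (hzv : z ≠ v) (F G : Set V → Set V → Set V → Set V → ℝ)
    (hF1 : ∀ a a' b c d, a ⊆ a' → F a b c d ≤ F a' b c d) (hF2 : ∀ a b b' c d, b ⊆ b' → F a b' c d ≤ F a b c d)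
    (hF3 : ∀ a b c c' d, c ⊆ c' → F a b c' d ≤ F a b c d) (hF4 : ∀ a b c d d', d ⊆ d' → F a b c d ≤ F a b c d')
    (hG1 : ∀ a a' b c d, a ⊆ a' → G a b c d ≤ G a' b c d) (hG2 : ∀ a b b' c d, b ⊆ b' → G a b' c d ≤ G a b c d)
    (hG3 : ∀ a b c c' d, c ⊆ c' → G a b c' d ≤ G a b c d) (hG4 : ∀ a b c d d', d ⊆ d' → G a b c d ≤ G a b c d') :
    0 ≤ ∑ s ∈ univ.filter (fun s : Finset ι => z ∉ openCluster (ends '' (↑s : Set ι)) x ∧ z ∉ openCluster (ends '' (↑(sᶜ) : Set ι)) x),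
      (F (openCluster (ends '' (↑s : Set ι)) x) (openCluster (ends '' (↑(sᶜ) : Set ι)) x)
          (openCluster (ends '' (↑s : Set ι)) z) (openCluster (ends '' (↑(sᶜ) : Set ι)) z)
        - F (openCluster (ends '' (↑(sᶜ) : Set ι)) x) (openCluster (ends '' (↑s : Set ι)) x)
          (openCluster (ends '' (↑(sᶜ) : Set ι)) z) (openCluster (ends '' (↑s : Set ι)) z)) *
      (G (openCluster (ends '' (↑s : Set ι)) x) (openCluster (ends '' (↑(sᶜ) : Set ι)) x)
          (openCluster (ends '' (↑s : Set ι)) z) (openCluster (ends '' (↑(sᶜ) : Set ι)) z)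
        - G (openCluster (ends '' (↑(sᶜ) : Set ι)) x) (openCluster (ends '' (↑s : Set ι)) x)
          (openCluster (ends '' (↑(sᶜ) : Set ι)) z) (openCluster (ends '' (↑s : Set ι)) z)) := by
  set K : Finset ι → Set V := fun s => openCluster (ends '' (↑s : Set ι)) x with hK
  set Cz : Finset ι → Set V := fun s => openCluster (ends '' (↑s : Set ι)) z with hCz
  set Cv : Finset ι → Set V := fun s => openCluster (ends '' (↑s : Set ι)) v with hCv
  set E' : Finset ι := univ.erase e₀ with hE'
  set Φ' : Finset ι → ℝ := fun t =>
    (F (K t) (K (E' \ t)) (insert z (Cv t)) ({z} : Set V) - F (K (E' \ t)) (K t) ({z} : Set V) (insert z (Cv t))) *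
    (G (K t) (K (E' \ t)) (insert z (Cv t)) ({z} : Set V) - G (K (E' \ t)) (K t) ({z} : Set V) (insert z (Cv t))) with hΦ'
  change 0 ≤ ∑ s ∈ univ.filter (fun s : Finset ι => z ∉ K s ∧ z ∉ K sᶜ),
    (F (K s) (K sᶜ) (Cz s) (Cz sᶜ) - F (K sᶜ) (K s) (Cz sᶜ) (Cz s)) * (G (K s) (K sᶜ) (Cz s) (Cz sᶜ) - G (K sᶜ) (K s) (Cz sᶜ) (Cz s))
  have he₀E' : e₀ ∉ E' := fun h => (Finset.mem_erase.mp h).1 rfl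
  have huniv : (univ : Finset (Finset ι)) = (insert e₀ E').powerset := by
    rw [hE', Finset.insert_erase (Finset.mem_univ e₀), Finset.powerset_univ]
  have hsubz : ∀ S : Set V, ({z} : Set V) ⊆ insert z S := by
    intro S y hy; rw [Set.mem_singleton_iff] at hy; subst hy; exact Set.mem_insert _ _
  -- the half-sum on `G − e₀`
  have hbase : 0 ≤ ∑ t ∈ E'.powerset.filter (fun t : Finset ι => v ∉ K t), Φ' t := by
    have := grand_offCluster_nonneg_sub ends E' x ({v} : Set V)
      (fun a b S => F a b (insert z S) ({z} : Set V)) (fun a b S => F a b ({z} : Set V) (insert z S))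
      (fun a b S => G a b (insert z S) ({z} : Set V)) (fun a b S => G a b ({z} : Set V) (insert z S))
      (fun a a' b S h => hF1 a a' b _ _ h) (fun a b b' S h => hF2 a b b' _ _ h)
      (fun a a' b S h => hF1 a a' b _ _ h) (fun a b b' S h => hF2 a b b' _ _ h)
      (fun a b S => le_trans (hF3 a b _ _ ({z} : Set V) (hsubz S)) (hF4 a b _ _ _ (hsubz S)))
      (fun a a' b S h => hG1 a a' b _ _ h) (fun a b b' S h => hG2 a b b' _ _ h)
      (fun a a' b S h => hG1 a a' b _ _ h) (fun a b b' S h => hG2 a b b' _ _ h)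
      (fun a b S => le_trans (hG3 a b _ _ ({z} : Set V) (hsubz S)) (hG4 a b _ _ _ (hsubz S)))
    simpa [hK, hΦ', hCv] using this
  have compl_of_sub : ∀ t, t ⊆ E' → tᶜ = insert e₀ (E' \ t) := by
    intro t ht
    ext i
    simp only [Finset.mem_compl, Finset.mem_insert, Finset.mem_sdiff, hE', Finset.mem_erase, Finset.mem_univ, and_true]
    constructor
    · intro hi
      by_cases hie : i = e₀
      · exact Or.inl hie
      · exact Or.inr ⟨hie, hi⟩
    · rintro (rfl | ⟨_, hi⟩)
      · exact fun h => he₀E' (ht h)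
      · exact hi
  have compl_insert_of_sub : ∀ t, t ⊆ E' → (insert e₀ t)ᶜ = E' \ t := by
    intro t ht
    ext i
    simp only [Finset.mem_compl, Finset.mem_insert, Finset.mem_sdiff, hE', Finset.mem_erase, Finset.mem_univ, and_true, not_or]
  have notin_of_sub : ∀ t, t ⊆ E' → e₀ ∉ t := fun t ht h => he₀E' (ht h)
  have notin_sdiff : ∀ t, e₀ ∉ E' \ t := fun t h => he₀E' (Finset.mem_sdiff.mp h).1
  rw [Finset.sum_filter, huniv, Finset.sum_powerset_insert he₀E']
  have h1 : ∑ t ∈ E'.powerset, (if z ∉ K t ∧ z ∉ K tᶜ then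
        (F (K t) (K tᶜ) (Cz t) (Cz tᶜ) - F (K tᶜ) (K t) (Cz tᶜ) (Cz t)) * (G (K t) (K tᶜ) (Cz t) (Cz tᶜ) - G (K tᶜ) (K t) (Cz tᶜ) (Cz t)) else 0) =
      ∑ t ∈ E'.powerset, (if v ∉ K (E' \ t) then
        (F (K t) (K (E' \ t)) ({z} : Set V) (insert z (Cv (E' \ t))) - F (K (E' \ t)) (K t) (insert z (Cv (E' \ t))) ({z} : Set V)) *
        (G (K t) (K (E' \ t)) ({z} : Set V) (insert z (Cv (E' \ t))) - G (K (E' \ t)) (K t) (insert z (Cv (E' \ t))) ({z} : Set V)) else 0) := by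
    refine Finset.sum_congr rfl fun t ht => ?_
    have hsub : t ⊆ E' := Finset.mem_powerset.mp ht
    have hzt : z ∉ K t := leaf_not_mem_openCluster ends hpend hzx (notin_of_sub t hsub)
    have hCzt : Cz t = ({z} : Set V) := openCluster_leaf_eq ends hpend (notin_of_sub t hsub)
    rw [compl_of_sub t hsub]
    have hCzc : Cz (insert e₀ (E' \ t)) = insert z (Cv (E' \ t)) := openCluster_leaf_insert ends he₀ hpend hzv (notin_sdiff t)
    by_cases hv : v ∈ K (E' \ t)
    · have hz : z ∈ K (insert e₀ (E' \ t)) := (leaf_mem_openCluster_insert_iff ends he₀ hpend hzx hzv (notin_sdiff t)).mpr hv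
      simp [hz, hv]
    · have hKc : K (insert e₀ (E' \ t)) = K (E' \ t) := openCluster_insert_pendant ends he₀ hpend hzx (notin_sdiff t) hv
      have hzc : z ∉ K (E' \ t) := leaf_not_mem_openCluster ends hpend hzx (notin_sdiff t)
      rw [hKc, hCzt, hCzc]
      simp [hzt, hzc, hv]
  have h2 : ∑ t ∈ E'.powerset, (if z ∉ K (insert e₀ t) ∧ z ∉ K (insert e₀ t)ᶜ then
        (F (K (insert e₀ t)) (K (insert e₀ t)ᶜ) (Cz (insert e₀ t)) (Cz (insert e₀ t)ᶜ) - F (K (insert e₀ t)ᶜ) (K (insert e₀ t)) (Cz (insert e₀ t)ᶜ) (Cz (insert e₀ t))) *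
        (G (K (insert e₀ t)) (K (insert e₀ t)ᶜ) (Cz (insert e₀ t)) (Cz (insert e₀ t)ᶜ) - G (K (insert e₀ t)ᶜ) (K (insert e₀ t)) (Cz (insert e₀ t)ᶜ) (Cz (insert e₀ t)))
        else 0) =
      ∑ t ∈ E'.powerset, (if v ∉ K t then Φ' t else 0) := by
    refine Finset.sum_congr rfl fun t ht => ?_
    have hsub : t ⊆ E' := Finset.mem_powerset.mp ht
    rw [compl_insert_of_sub t hsub]
    have hzc : z ∉ K (E' \ t) := leaf_not_mem_openCluster ends hpend hzx (notin_sdiff t)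
    have hCzi : Cz (insert e₀ t) = insert z (Cv t) := openCluster_leaf_insert ends he₀ hpend hzv (notin_of_sub t hsub)
    have hCzc : Cz (E' \ t) = ({z} : Set V) := openCluster_leaf_eq ends hpend (notin_sdiff t)
    by_cases hv : v ∈ K t
    · have hz : z ∈ K (insert e₀ t) := (leaf_mem_openCluster_insert_iff ends he₀ hpend hzx hzv (notin_of_sub t hsub)).mpr hv
      simp [hz, hv]
    · have hKi : K (insert e₀ t) = K t := openCluster_insert_pendant ends he₀ hpend hzx (notin_of_sub t hsub) hv
      have hzt : z ∉ K t := leaf_not_mem_openCluster ends hpend hzx (notin_of_sub t hsub)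
      rw [hKi, hCzi, hCzc]
      simp [hzt, hzc, hv, hΦ']
  have h3 : ∑ t ∈ E'.powerset, (if v ∉ K (E' \ t) then
        (F (K t) (K (E' \ t)) ({z} : Set V) (insert z (Cv (E' \ t))) - F (K (E' \ t)) (K t) (insert z (Cv (E' \ t))) ({z} : Set V)) *
        (G (K t) (K (E' \ t)) ({z} : Set V) (insert z (Cv (E' \ t))) - G (K (E' \ t)) (K t) (insert z (Cv (E' \ t))) ({z} : Set V)) else 0) =
      ∑ t ∈ E'.powerset, (if v ∉ K t then Φ' t else 0) := by
    refine Finset.sum_bij' (fun t _ => E' \ t) (fun t _ => E' \ t) ?_ ?_ ?_ ?_ ?_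
    · intro t _; exact Finset.mem_powerset.mpr Finset.sdiff_subset
    · intro t _; exact Finset.mem_powerset.mpr Finset.sdiff_subset
    · intro t ht; exact Finset.sdiff_sdiff_eq_self (Finset.mem_powerset.mp ht)
    · intro t ht; exact Finset.sdiff_sdiff_eq_self (Finset.mem_powerset.mp ht)
    · intro t ht
      have hsub : t ⊆ E' := Finset.mem_powerset.mp ht
      simp only [hΦ', Finset.sdiff_sdiff_eq_self hsub]
      by_cases hv : v ∈ K (E' \ t)
      · simp [hv]
      · simp [hv]; ring
  rw [h1, h2, h3, ← Finset.sum_filter]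
  linarith [hbase]

end pendant

end Coefficientwise

end Summit.CriticalPhenomena.PercolationContinuityZ3.Theorems
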